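import Summits.AtomisticToContinuum.HydrodynamicLimit.Theorems.OneFlightGossipEngineKineticCurrentsWindowLDUniformClassTruncationReduced
import Literature.MathematicalPhysics.KineticTheory.HardSphereEuler
import HarnessLib

/-!
# The re-orthogonalised low-speed heat-flux cut-off (stub `stub_loHeatFluxCutoff`, line
# `IdeatorTwoSketch`, crux `ClampedCurrentsDock`, stmt-AtomisticToContinuum-14680)

Helper file (`--supports stmt-AtomisticToContinuum-14680`) proving the registered stub
`stub_loHeatFluxCutoff : LoHeatFluxCutoff` (S11) of the lead's skeleton
(`Cruxes/ClampedCurrentsDock/Lines/IdeatorTwoSketch.lean`). The TRUE fast heat flux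
`(b·w)(|w|² − 5θ)`, `w = v − u₀(x)`, is cubic and not in the quadratic-growth class of the kinetic
window LD (`KineticCurrentsWindowLDUniform`); the line splits it at a FIXED speed `K⋆`. The low part
must be a continuous profile `G(x, |w|²)`, bounded on `s ≥ 0`, agreeing with `s − 5θ₀(x)` for
`s ≤ K⋆²`, such that `F(x,v) = (b(x)·w) G(x,|w|²)` is of quadratic growth and orthogonal to
`1, v_k, |v|²` under the local Maxwellian `M_{1,u₀(x),θ₀(x)}` at every `x`.

Construction (static Gaussian analysis with the `ClassTruncation` toolkit of crux 14662):
`G(x,s) = (s − 5θ₀(x)) χ_L(s) − ρ(x) r₀(s/θ₀(x))` with `L = K⋆²`, the cutoff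
`χ_L(s) = min 1 (max 0 (2 − s/L))` (`= 1` on `s ≤ L`, `= 0` beyond `2L`), the tent
`r₀(t) = max 0 (1 − |t − (T₀+1)|)` supported in `[T₀, T₀+2]`, `T₀ = L / min θ₀` (so that the
correction vanishes for `s ≤ L` at every `x`), and `ρ = R/m₀` with the reference moment
`m₀ = E[ξ₀² r₀(‖ξ‖²)] > 0` (the standard Gaussian charges open sets) and the continuous
(dominated convergence) truncated moment `R(x) = E[ξ₀² (θ₀‖ξ‖² − 5θ₀) χ_L(θ₀‖ξ‖²)]`. For the ODD
functional `(b·w)G` the three orthogonality conditions reduce, in the reduced variable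
`v = u₀ + √θ₀ ξ`, to the ONE scalar condition `E[ξ₀² G(x, θ₀‖ξ‖²)] = R − ρ m₀ = 0`
(`ClassTruncation.truncated_gauss_orth` with `A = 0`, `ClassTruncation.maxwellian_orth_of_gauss_orth`).
-/

noncomputable section

namespace Summit.AtomisticToContinuum.HydrodynamicLimit.Theorems.ClampedCurrentsDockCutoff

open MeasureTheory Filter Set Topology
open Literature.MathematicalPhysics.KineticTheory Literature.Analysis.FluidPDE Literature.Analysis.FunctionSpaces
open ProbabilityTheory
open Summit.AtomisticToContinuum.HydrodynamicLimit.Theorems.KineticCurrentsWindowLDUniformSketch.ClassTruncation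

/-! ## The statement

Re-declared from the line skeleton (S11). Clause (2) is boundedness on `s ≥ 0`, the only values
`s = |w|²` at which `G` is ever evaluated: demanded for ALL real `s` it would contradict clause (3)
(`G(x,s) = s − 5θ₀(x)` for every `s ≤ K⋆²`) as `s → −∞`. -/

/-- **S11 — the re-orthogonalised low-speed heat-flux cut-off (worker-sized real analysis).** For continuous
`θ₀ > 0`, `u₀`, `b` and a cut-off level `K⋆ > 0` there is a continuous, quadratically bounded profile `G(x, s)` which
AGREES with the true fast heat-flux profile `s − 5θ₀(x)` for `s ≤ K⋆²`, is bounded on `s ≥ 0` (the only values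
`s = |w|²` at which it is ever evaluated), and keeps the functional
`F(x,v) = (b(x)·w) G(x, |w|²)`, `w = v − u₀(x)`, in the class of `KineticCurrentsWindowLDUniform`: orthogonal to
`1, v_k, |v|²` under the local Maxwellian `M_{1,u₀(x),θ₀(x)}` at every `x` (all three reduce to the ONE scalar condition
`∫ |w|² G(x,|w|²) M dw = 0`; take `G = (s − 5θ₀)χ(s) + c(x)ψ(s)` with a fixed bump `ψ` supported above `K⋆²` and the
continuous compensating amplitude `c(x)`). This is the "lo" part of the cubic channel fed to KCWU at the FIXED tilt
`β₀(K⋆)`; the complement `(s − 5θ₀)(1 − χ) − cψ` lives on `{|w| > K⋆}` and is the "hi" part priced pathwise (S6 + ECT). -/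
def LoHeatFluxCutoff : Prop :=
  ∀ (θ₀ : T3 → ℝ) (u₀ b : T3 → V3), Continuous θ₀ → Continuous u₀ → Continuous b → (∀ x, 0 < θ₀ x) →
    ∀ Kstar : ℝ, 0 < Kstar → ∃ G : T3 × ℝ → ℝ, Continuous G ∧
      (∃ C : ℝ, ∀ y : T3 × ℝ, 0 ≤ y.2 → |G y| ≤ C) ∧
      (∀ (x : T3) (s : ℝ), s ≤ Kstar ^ 2 → G (x, s) = s - 5 * θ₀ x) ∧
      (∃ C : ℝ, ∀ y : T3 × V3,
        |(∑ j : Fin 3, b y.1 j * (y.2 - u₀ y.1) j) * G (y.1, ‖y.2 - u₀ y.1‖ ^ 2)| ≤ C * (1 + ‖y.2‖ ^ 2)) ∧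
      (∀ x, ∫ v, ((∑ j : Fin 3, b x j * (v - u₀ x) j) * G (x, ‖v - u₀ x‖ ^ 2)) *
        localMaxwellian 1 (θ₀ x) (u₀ x) v = 0) ∧
      (∀ x (k : Fin 3), ∫ v, ((∑ j : Fin 3, b x j * (v - u₀ x) j) * G (x, ‖v - u₀ x‖ ^ 2)) * v k *
        localMaxwellian 1 (θ₀ x) (u₀ x) v = 0) ∧
      (∀ x, ∫ v, ((∑ j : Fin 3, b x j * (v - u₀ x) j) * G (x, ‖v - u₀ x‖ ^ 2)) * ‖v‖ ^ 2 *
        localMaxwellian 1 (θ₀ x) (u₀ x) v = 0)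

/-! ## One-dimensional profiles -/

/-- The cutoff `χ_L(s) = min 1 (max 0 (2 − s/L))` equals `1` on `s ≤ L` (`L > 0`). [folklore] -/
theorem cutoff_eq_one {L : ℝ} (hL : 0 < L) {χ : ℝ → ℝ}
    (hχ : ∀ s, χ s = min 1 (max 0 (2 - s / L))) (s : ℝ) (hs : s ≤ L) : χ s = 1 := by
  have h : s / L ≤ 1 := (div_le_one hL).2 hs
  rw [hχ, max_eq_right (by linarith), min_eq_left (by linarith)]

/-- The tent `r₀(t) = max 0 (1 − |t − (T + 1)|)`: continuous, values in `[0,1]`, vanishing for `t ≤ T`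
and for `t ≥ T + 2`, equal to `1` at `t = T + 1`. [folklore] -/
theorem tent_props (T : ℝ) {r : ℝ → ℝ} (hr : ∀ t, r t = max 0 (1 - |t - (T + 1)|)) :
    Continuous r ∧ (∀ t, 0 ≤ r t) ∧ (∀ t, r t ≤ 1) ∧ (∀ t, t ≤ T → r t = 0) ∧
      (∀ t, T + 2 ≤ t → r t = 0) ∧ r (T + 1) = 1 := by
  have hfun : r = fun t => max 0 (1 - |t - (T + 1)|) := funext hr
  refine ⟨by rw [hfun]; fun_prop, fun t => by rw [hr]; exact le_max_left _ _,
    fun t => by rw [hr]; exact max_le zero_le_one (by linarith [abs_nonneg (t - (T + 1))]),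
    fun t ht => ?_, fun t ht => ?_, ?_⟩
  · have h : 1 ≤ |t - (T + 1)| := by rw [abs_of_nonpos (by linarith)]; linarith
    rw [hr, max_eq_left (by linarith)]
  · have h : 1 ≤ |t - (T + 1)| := by rw [abs_of_nonneg (by linarith)]; linarith
    rw [hr, max_eq_left (by linarith)]
  · rw [hr, sub_self, abs_zero, sub_zero, max_eq_right zero_le_one]

/-! ## Gaussian facts -/

-- adapted from Literature/Analysis/UnboundedOperators/LinearizedBoltzmannPositivityProofs.lean
-- (`isOpenPosMeasure_stdGaussian`), specialised to `V3`
/-- The standard Gaussian on `ℝ³` charges every nonempty open set (image of a product of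
one-dimensional Gaussians, each mutually absolutely continuous with Lebesgue measure, under a continuous
linear surjection). [folklore] -/
theorem isOpenPosMeasure_stdGaussian_V3 : (stdGaussian V3).IsOpenPosMeasure := by
  haveI : (gaussianReal 0 1).IsOpenPosMeasure :=
    (gaussianReal_absolutelyContinuous' 0 one_ne_zero).isOpenPosMeasure
  rw [stdGaussian]
  refine Continuous.isOpenPosMeasure_map (by fun_prop) fun v => ?_
  exact ⟨fun i => (stdOrthonormalBasis ℝ V3).repr v i, (stdOrthonormalBasis ℝ V3).sum_repr v⟩

/-- `|b·w| ≤ ‖b‖ (1 + ‖w‖²)` (Cauchy–Schwarz and `‖w‖ ≤ 1 + ‖w‖²`). [folklore] -/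
theorem abs_lin_le (b w : V3) : |∑ j, b j * w j| ≤ ‖b‖ * (1 + ‖w‖ ^ 2) := by
  have hin : inner ℝ b w = ∑ j, b j * w j := by simp [PiLp.inner_apply, mul_comm]
  have h1 : |∑ j, b j * w j| ≤ ‖b‖ * ‖w‖ := by rw [← hin]; exact abs_real_inner_le_norm _ _
  exact h1.trans (mul_le_mul_of_nonneg_left
    (by nlinarith [norm_nonneg w, sq_nonneg (‖w‖ - 1)]) (norm_nonneg _))

/-- The odd class member in the reduced variable: with `w = √θ ξ`,
`(b·w) G(|w|²) = √θ (b·ξ) G(θ‖ξ‖²)`. [folklore] -/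
theorem lin_shift {θ : ℝ} (hθ : 0 ≤ θ) (u b : V3) (Gs : ℝ → ℝ) (ξ : V3) :
    (∑ j, b j * (u + Real.sqrt θ • ξ - u) j) * Gs (‖u + Real.sqrt θ • ξ - u‖ ^ 2) =
      Real.sqrt θ * (∑ j, b j * ξ j) * Gs (θ * ‖ξ‖ ^ 2) := by
  have hn : ‖Real.sqrt θ • ξ‖ ^ 2 = θ * ‖ξ‖ ^ 2 := by
    rw [norm_smul, mul_pow, Real.norm_eq_abs, sq_abs, Real.sq_sqrt hθ]
  simp only [add_sub_cancel_left, hn, PiLp.smul_apply, smul_eq_mul]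
  have h2 : (∑ j, b j * (Real.sqrt θ * ξ j)) = Real.sqrt θ * ∑ j, b j * ξ j := by
    rw [Finset.mul_sum]; exact Finset.sum_congr rfl fun j _ => by ring
  rw [h2]

/-- **Orthogonality of an odd class member from the one scalar condition.** For `θ > 0`, a continuous
radial profile `G` bounded on `s ≥ 0` and vanishing beyond `S ≥ 0`, the functional
`Φ(v) = (b·w) G(|w|²)`, `w = v − u`, is orthogonal to `1, v_k, ‖v‖²` under `M_{1,u,θ}` as soon as
`E[ξ₀² G(θ‖ξ‖²)] = 0` (`truncated_gauss_orth` with `A = 0`, then `maxwellian_orth_of_gauss_orth`).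
[folklore] -/
theorem odd_member_orth {θ : ℝ} (hθ : 0 < θ) (u b : V3) {Gx : ℝ → ℝ} (hGc : Continuous Gx)
    {C : ℝ} (hC : ∀ s, 0 ≤ s → |Gx s| ≤ C) {S : ℝ} (hS0 : 0 ≤ S) (hS : ∀ s, S ≤ s → Gx s = 0)
    (hm : ∫ ξ, ξ 0 * ξ 0 * Gx (θ * ‖ξ‖ ^ 2) ∂stdGaussian V3 = 0) :
    (∫ v, (∑ j, b j * (v - u) j) * Gx (‖v - u‖ ^ 2) * localMaxwellian 1 θ u v = 0) ∧
      (∀ k, ∫ v, (∑ j, b j * (v - u) j) * Gx (‖v - u‖ ^ 2) * v k * localMaxwellian 1 θ u v = 0) ∧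
      ∫ v, (∑ j, b j * (v - u) j) * Gx (‖v - u‖ ^ 2) * ‖v‖ ^ 2 * localMaxwellian 1 θ u v = 0 := by
  have hC0 : 0 ≤ C := (abs_nonneg _).trans (hC 0 le_rfl)
  -- `Φ` is bounded: it vanishes for `|w|² ≥ S` and `|b·w| ≤ ‖b‖(1 + |w|²)` below
  have hB : ∀ v : V3, |(∑ j, b j * (v - u) j) * Gx (‖v - u‖ ^ 2)| ≤ ‖b‖ * (1 + S) * C := by
    intro v
    by_cases hw : S ≤ ‖v - u‖ ^ 2
    · rw [hS _ hw, mul_zero, abs_zero]; positivity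
    · rw [abs_mul]
      calc |∑ j, b j * (v - u) j| * |Gx (‖v - u‖ ^ 2)| ≤ ‖b‖ * (1 + ‖v - u‖ ^ 2) * C :=
            mul_le_mul (abs_lin_le b _) (hC _ (sq_nonneg _)) (abs_nonneg _) (by positivity)
        _ ≤ ‖b‖ * (1 + S) * C := by gcongr; exact (not_le.1 hw).le
  have htr : ∑ j : Fin 3, (0 : Fin 3 → Fin 3 → ℝ) j j = 0 := by simp
  have hsh : ∀ ξ : V3,
      (∑ j, b j * (u + Real.sqrt θ • ξ - u) j) * Gx (‖u + Real.sqrt θ • ξ - u‖ ^ 2) =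
        θ * (∑ j, ∑ k, (0 : Fin 3 → Fin 3 → ℝ) j k * (ξ j * ξ k)) * 1 +
          Real.sqrt θ * (∑ j, b j * ξ j) * Gx (θ * ‖ξ‖ ^ 2) := by
    intro ξ
    simp only [Pi.zero_apply, zero_mul, Finset.sum_const_zero, mul_zero, mul_one, zero_add]
    exact lin_shift hθ.le u b Gx ξ
  obtain ⟨h0, h1, h2⟩ := truncated_gauss_orth (θ := θ) htr (b := b) (χ := fun _ => (1 : ℝ))
    (lam := fun s => Gx (θ * s)) continuous_const (fun _ => zero_le_one) (fun _ => le_rfl)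
    (by fun_prop) (Q := C) (fun s hs => le_mul_one_add (hC _ (mul_nonneg hθ.le hs)) hC0 hs) hm
    (f := fun ξ => (∑ j, b j * (u + Real.sqrt θ • ξ - u) j) * Gx (‖u + Real.sqrt θ • ξ - u‖ ^ 2))
    (by fun_prop) (fun ξ => hB _) hsh
  exact maxwellian_orth_of_gauss_orth
    (Φ := fun v => (∑ j, b j * (v - u) j) * Gx (‖v - u‖ ^ 2)) (by fun_prop) hθ u hB h0 h1 h2

/-! ## The stub -/

/-- **S11 `stub_loHeatFluxCutoff`** (line `IdeatorTwoSketch`, crux stmt-AtomisticToContinuum-14680): the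
re-orthogonalised low-speed heat-flux cut-off exists. Construction `G(x,s) = (s − 5θ₀(x))χ_L(s) −
ρ(x) r₀(s/θ₀(x))`, `L = K⋆²`, `ρ = R/m₀` (module docstring); continuity of `R` by dominated convergence,
`m₀ > 0` because the Gaussian charges open sets, orthogonality by `odd_member_orth`. [folklore] -/
theorem stub_loHeatFluxCutoff : LoHeatFluxCutoff := by
  intro θ₀ u₀ b hθc huc hbc hθpos Kstar hK
  /- Step 0: constants from the compactness of `𝕋³`. -/
  obtain ⟨θM, -, hθM'⟩ := exists_forall_abs_le_of_continuous hθc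
  have hθM : ∀ x, θ₀ x ≤ θM := fun x => (le_abs_self _).trans (hθM' x)
  have hθM0 : 0 < θM := (hθpos 0).trans_le (hθM 0)
  obtain ⟨xm, -, hxm⟩ := isCompact_univ.exists_isMinOn univ_nonempty hθc.continuousOn
  have hθm : ∀ x, θ₀ xm ≤ θ₀ x := fun x => isMinOn_iff.1 hxm x (mem_univ x)
  have hθm0 : 0 < θ₀ xm := hθpos xm
  obtain ⟨U, hU0, hU'⟩ := exists_forall_abs_le_of_continuous (continuous_norm.comp huc)
  have hU : ∀ x, ‖u₀ x‖ ≤ U := fun x => (le_abs_self _).trans (hU' x)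
  obtain ⟨Bb, hBb0, hBb'⟩ := exists_forall_abs_le_of_continuous (continuous_norm.comp hbc)
  have hBb : ∀ x, ‖b x‖ ≤ Bb := fun x => (le_abs_self _).trans (hBb' x)
  /- Step 1: the cutoff `χ = χ_L`, `L = K⋆²`, and the tent `r₀` above `T₀ = L / min θ₀`. -/
  set L : ℝ := Kstar ^ 2 with hL
  have hL0 : 0 < L := pow_pos hK 2
  set χ : ℝ → ℝ := fun s => min 1 (max 0 (2 - s / L)) with hχ
  have hχlo : ∀ s, s ≤ L → χ s = 1 := cutoff_eq_one hL0 (χ := χ) fun s => by rw [hχ]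
  obtain ⟨hχc, hχ0, hχ1, hχhi, -⟩ := cutoff_props hL0 (χ := χ) fun s => by rw [hχ]
  clear_value χ
  set T₀ : ℝ := L / θ₀ xm with hT₀
  have hT₀0 : 0 < T₀ := div_pos hL0 hθm0
  set r₀ : ℝ → ℝ := fun t => max 0 (1 - |t - (T₀ + 1)|) with hr₀
  obtain ⟨hr₀c, hr₀0, hr₀1, hr₀lo, hr₀hi, hr₀one⟩ := tent_props T₀ (r := r₀) fun t => by rw [hr₀]
  clear_value r₀
  have hr₀abs : ∀ t, 0 ≤ t → |r₀ t| ≤ 1 * (1 + t) := fun t ht =>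
    le_mul_one_add (by rw [abs_of_nonneg (hr₀0 t)]; exact hr₀1 t) zero_le_one ht
  /- Step 2: the reference moment `m₀ = E[ξ₀² r₀(‖ξ‖²)] > 0`. -/
  have hir₀ : Integrable (fun ξ : V3 => ξ 0 * ξ 0 * r₀ (‖ξ‖ ^ 2)) (stdGaussian V3) :=
    integrable_coord_mul_weight 0 0 hr₀c hr₀abs
  set m₀ : ℝ := ∫ ξ, ξ 0 * ξ 0 * r₀ (‖ξ‖ ^ 2) ∂stdGaussian V3 with hm₀def
  have hm₀ : 0 < m₀ := by
    haveI := isOpenPosMeasure_stdGaussian_V3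
    have hpt : (EuclideanSpace.single (0 : Fin 3) (Real.sqrt (T₀ + 1)) : V3) 0 = Real.sqrt (T₀ + 1) := by
      simp
    have hn : ‖(EuclideanSpace.single (0 : Fin 3) (Real.sqrt (T₀ + 1)) : V3)‖ ^ 2 = T₀ + 1 := by
      rw [PiLp.norm_single, Real.norm_eq_abs, sq_abs, Real.sq_sqrt (by positivity)]
    rw [hm₀def]
    refine integral_pos_of_integrable_nonneg_nonzero
      (x := (EuclideanSpace.single (0 : Fin 3) (Real.sqrt (T₀ + 1)) : V3)) (by fun_prop) hir₀
      (fun ξ => mul_nonneg (mul_self_nonneg _) (hr₀0 _)) ?_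
    beta_reduce
    rw [hpt, hn, hr₀one, mul_one, Real.mul_self_sqrt (by positivity)]
    positivity
  clear_value m₀
  /- Step 3: the truncated profile is bounded; the tail moment `R` (continuous by dominated convergence)
  and the compensating amplitude `ρ = R/m₀`. -/
  have hq : ∀ x s, 0 ≤ s → |(s - 5 * θ₀ x) * χ s| ≤ 2 * L + 5 * θM := by
    intro x s hs
    by_cases h : s ≤ 2 * L
    · rw [abs_mul, abs_of_nonneg (hχ0 s)]
      calc |s - 5 * θ₀ x| * χ s ≤ |s - 5 * θ₀ x| * 1 :=
            mul_le_mul_of_nonneg_left (hχ1 s) (abs_nonneg _)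
        _ ≤ 2 * L + 5 * θM := by
            rw [mul_one]
            refine (abs_sub _ _).trans ?_
            rw [abs_of_nonneg hs, abs_of_nonneg (by have := hθpos x; positivity)]
            linarith [hθM x]
    · rw [hχhi s (not_le.1 h).le, mul_zero, abs_zero]; positivity
  have hGM0 : 0 ≤ 2 * L + 5 * θM := by positivity
  set R : T3 → ℝ := fun x => ∫ ξ, ξ 0 * ξ 0 *
    ((θ₀ x * ‖ξ‖ ^ 2 - 5 * θ₀ x) * χ (θ₀ x * ‖ξ‖ ^ 2)) ∂stdGaussian V3 with hR
  have hRc : Continuous R := by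
    refine continuous_of_dominated (bound := fun ξ : V3 => 1 * 1 * (2 * L + 5 * θM) * (1 + ‖ξ‖ ^ 2) ^ 3)
      (fun x => (by fun_prop : Continuous fun ξ : V3 => ξ 0 * ξ 0 *
        ((θ₀ x * ‖ξ‖ ^ 2 - 5 * θ₀ x) * χ (θ₀ x * ‖ξ‖ ^ 2))).aestronglyMeasurable)
      (fun x => ae_of_all _ fun ξ => ?_) (integrable_one_add_norm_sq_cube.const_mul _)
      (ae_of_all _ fun ξ => by fun_prop)
    rw [Real.norm_eq_abs]
    exact abs_mul_three_le (abs_coord_le' ξ 0) (abs_coord_le' ξ 0)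
      (le_mul_one_add (hq x _ (mul_nonneg (hθpos x).le (sq_nonneg _))) hGM0 (sq_nonneg _))
  set ρ : T3 → ℝ := fun x => R x / m₀ with hρ
  have hρc : Continuous ρ := by rw [hρ]; exact hRc.div_const _
  clear_value R ρ
  obtain ⟨ρM, hρM0, hρM⟩ := exists_forall_abs_le_of_continuous hρc
  /- Step 4: the profile `G` and its pointwise properties. -/
  set G : T3 × ℝ → ℝ := fun p => (p.2 - 5 * θ₀ p.1) * χ p.2 - ρ p.1 * r₀ (p.2 / θ₀ p.1) with hG
  have hGc : Continuous G := by
    have hd : Continuous fun p : T3 × ℝ => p.2 / θ₀ p.1 :=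
      continuous_snd.div (hθc.comp continuous_fst) fun p => (hθpos p.1).ne'
    have h1 : Continuous fun p : T3 × ℝ => (p.2 - 5 * θ₀ p.1) * χ p.2 := by fun_prop
    rw [hG]
    exact h1.sub ((hρc.comp continuous_fst).mul (hr₀c.comp hd))
  have hGlo : ∀ x s, s ≤ L → G (x, s) = s - 5 * θ₀ x := by
    intro x s hs
    have h1 : s / θ₀ x ≤ T₀ := by
      rw [div_le_iff₀ (hθpos x)]
      calc s ≤ L := hs
        _ = T₀ * θ₀ xm := by rw [hT₀, div_mul_cancel₀ _ hθm0.ne']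
        _ ≤ T₀ * θ₀ x := mul_le_mul_of_nonneg_left (hθm x) hT₀0.le
    simp only [hG]
    rw [hχlo s hs, hr₀lo _ h1]; ring
  set S₀ : ℝ := max (2 * L) ((T₀ + 2) * θM) with hS₀
  have hS₀0 : 0 ≤ S₀ := le_max_of_le_left (by positivity)
  have hGhi : ∀ x s, S₀ ≤ s → G (x, s) = 0 := by
    intro x s hs
    have h1 : 2 * L ≤ s := (le_max_left _ _).trans hs
    have h2 : T₀ + 2 ≤ s / θ₀ x := by
      rw [le_div_iff₀ (hθpos x)]
      calc (T₀ + 2) * θ₀ x ≤ (T₀ + 2) * θM := mul_le_mul_of_nonneg_left (hθM x) (by positivity)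
        _ ≤ S₀ := le_max_right _ _
        _ ≤ s := hs
    simp only [hG]
    rw [hχhi s h1, hr₀hi _ h2]; ring
  set CG : ℝ := 2 * L + 5 * θM + ρM with hCG
  have hCG0 : 0 ≤ CG := by rw [hCG]; positivity
  have hGbd : ∀ x s, 0 ≤ s → |G (x, s)| ≤ CG := by
    intro x s hs
    simp only [hG]
    refine (abs_sub _ _).trans (add_le_add (hq x s hs) ?_)
    rw [abs_mul]
    exact (mul_le_mul (hρM x) (by rw [abs_of_nonneg (hr₀0 _)]; exact hr₀1 _) (abs_nonneg _)
      hρM0).trans (le_of_eq (mul_one _))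
  /- Step 5: the scalar re-orthogonalisation identity `E[ξ₀² G(x, θ₀‖ξ‖²)] = R − ρ m₀ = 0`. -/
  have hscalar : ∀ x, ∫ ξ : V3, ξ 0 * ξ 0 * G (x, θ₀ x * ‖ξ‖ ^ 2) ∂stdGaussian V3 = 0 := by
    intro x
    have hGsh : ∀ ξ : V3, ξ 0 * ξ 0 * G (x, θ₀ x * ‖ξ‖ ^ 2) =
        ξ 0 * ξ 0 * ((θ₀ x * ‖ξ‖ ^ 2 - 5 * θ₀ x) * χ (θ₀ x * ‖ξ‖ ^ 2)) -
          ρ x * (ξ 0 * ξ 0 * r₀ (‖ξ‖ ^ 2)) := by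
      intro ξ; simp only [hG]; rw [mul_div_cancel_left₀ _ (hθpos x).ne']; ring
    have hi1 : Integrable (fun ξ : V3 => ξ 0 * ξ 0 *
        ((θ₀ x * ‖ξ‖ ^ 2 - 5 * θ₀ x) * χ (θ₀ x * ‖ξ‖ ^ 2))) (stdGaussian V3) :=
      integrable_coord_mul_weight 0 0 (ω := fun t => (θ₀ x * t - 5 * θ₀ x) * χ (θ₀ x * t))
        (by fun_prop) (P := 2 * L + 5 * θM)
        (fun t ht => le_mul_one_add (hq x _ (mul_nonneg (hθpos x).le ht)) hGM0 ht)
    simp_rw [hGsh]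
    rw [integral_sub hi1 (hir₀.const_mul _), integral_const_mul, ← hm₀def, hρ,
      div_mul_cancel₀ _ hm₀.ne', sub_eq_zero, hR]
  /- Step 6: assembly (growth of `F = (b·w)G`; orthogonality by `odd_member_orth`). -/
  have horth := fun x => odd_member_orth (hθpos x) (u₀ x) (b x) (Gx := fun s => G (x, s))
    (by fun_prop) (C := CG) (fun s hs => hGbd x s hs) hS₀0 (fun s hs => hGhi x s hs) (hscalar x)
  refine ⟨G, hGc, ⟨CG, fun y hy => hGbd y.1 y.2 hy⟩, hGlo, ⟨Bb * CG * (2 + 2 * U ^ 2), fun y => ?_⟩,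
    fun x => (horth x).1, fun x k => (horth x).2.1 k, fun x => (horth x).2.2⟩
  have h1 := abs_lin_le (b y.1) (y.2 - u₀ y.1)
  have h2 := hGbd y.1 _ (sq_nonneg ‖y.2 - u₀ y.1‖)
  have hw : ‖y.2 - u₀ y.1‖ ^ 2 ≤ 2 * ‖y.2‖ ^ 2 + 2 * U ^ 2 := by
    have h3 := norm_sub_le y.2 (u₀ y.1)
    have h4 : ‖u₀ y.1‖ ^ 2 ≤ U ^ 2 := pow_le_pow_left₀ (norm_nonneg _) (hU y.1) 2
    nlinarith [norm_nonneg (y.2 - u₀ y.1), norm_nonneg y.2, norm_nonneg (u₀ y.1),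
      sq_nonneg (‖y.2‖ - ‖u₀ y.1‖)]
  have h5 : 0 ≤ Bb * CG * (1 + 2 * U ^ 2 * ‖y.2‖ ^ 2) := by positivity
  rw [abs_mul]
  calc |∑ j, b y.1 j * (y.2 - u₀ y.1) j| * |G (y.1, ‖y.2 - u₀ y.1‖ ^ 2)|
      ≤ ‖b y.1‖ * (1 + ‖y.2 - u₀ y.1‖ ^ 2) * CG := mul_le_mul h1 h2 (abs_nonneg _) (by positivity)
    _ ≤ Bb * (1 + (2 * ‖y.2‖ ^ 2 + 2 * U ^ 2)) * CG := by gcongr; exact hBb y.1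
    _ ≤ Bb * CG * (2 + 2 * U ^ 2) * (1 + ‖y.2‖ ^ 2) := by nlinarith [h5]

end Summit.AtomisticToContinuum.HydrodynamicLimit.Theorems.ClampedCurrentsDockCutoff

end
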